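import Mathlib
import Summits.Ventures.PercRepro2.Defs
import Summits.Ventures.PercRepro2.Harris
import Summits.Ventures.PercRepro2.CoinDefs
import Summits.Ventures.PercRepro2.CoinInduced
import Summits.Ventures.PercRepro2.CoinFrontier
import Summits.Ventures.PercRepro2.CoinVdBK

/-!
# Lemma A (avoid-more positivity) and the BASE row on MIXED coin systems (blind cell PercRepro2,
night-2)

The directed counterparts of the cell's `LemmaA.lean` (typer-1 / mine-c) on a `SameEnds` coin
system, in the cleared vocabulary of `CoinDefs.lean` (`phiC`, `covC`, `massE`, `marker`):

* `base_nonneg` — **BASE** (directed BHK 1.3 for the point markers): `Φ(R_T) = P(R_T)·Cov(X,Y|R_T)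
  ≥ 0`, cleared: `phiC p arcs s T a b (avoidEvent arcs s T) ≥ 0`;
* `lemmaA_nonneg` — **Lemma A**: for every further avoided set `U`,
  `Φ(R_{T∪U}) = E[(X − m_X)(Y − m_Y); s ↛ T ∪ U] ≥ 0` with `m = E[· | R_T]`, cleared:
  `phiC p arcs s T a b (avoidEvent arcs s (T ∪ U)) ≥ 0` — the `u ∉ S⁺` branch of the one-arc gate
  (`gateEvent_eq_union`), i.e. the case `w ∈ T` of row 2′DARC.

Both are the identity of `LemmaA.lean`: `P(R_{T∪U}) · phiC(R_{T∪U}) = P(R_T)² · covC(R_{T∪U})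
+ (shift_X) · (shift_Y)` with `covC ≥ 0` (`covC_nonneg`) and both shifts `≤ 0`
(`shift_avoid_more_C`); `P(R_{T∪U}) = 0` is degenerate (everything vanishes).
-/

namespace Summit.Ventures.PercRepro2.Coin

section LemmaA

open Classical

variable {V : Type*} {E : Type*} [Fintype E] [DecidableEq E] [Fintype V] [DecidableEq V]
  {R : Type*} [Field R] [LinearOrder R] [IsStrictOrderedRing R]

omit [Fintype V] [DecidableEq V] in
/-- `E[X; 𝒟] ≤ P(𝒟)` and `≥ 0` for the point marker (cleared helpers). -/
lemma massE_marker_le_prob (p : E → R) (hp : IsProbVec p) (arcs : E → Finset (V × V)) (s a : V)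
    (D : Set (Config E)) :
    massE p (marker (R := R) arcs s a) D ≤ prob p D := by
  rw [massE_marker_eq_prob]
  exact prob_mono hp Set.inter_subset_right

omit [Fintype V] [DecidableEq V] in
/-- `E[X; 𝒟] ≥ 0` for the point marker. -/
lemma massE_marker_nonneg (p : E → R) (hp : IsProbVec p) (arcs : E → Finset (V × V)) (s a : V)
    (D : Set (Config E)) : 0 ≤ massE p (marker (R := R) arcs s a) D := by
  rw [massE_marker_eq_prob]
  exact prob_nonneg hp _

omit [Fintype V] [DecidableEq V] in
/-- `E[XY; 𝒟] ≥ 0` for the point markers. -/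
lemma massE_marker_mul_nonneg (p : E → R) (hp : IsProbVec p) (arcs : E → Finset (V × V))
    (s a b : V) (D : Set (Config E)) :
    0 ≤ massE p (fun ω => marker (R := R) arcs s a ω * marker (R := R) arcs s b ω) D := by
  rw [massE_marker_mul_eq_prob]
  exact prob_nonneg hp _

omit [Fintype V] [DecidableEq V] in
/-- `E[XY; 𝒟] ≤ P(𝒟)` for the point markers. -/
lemma massE_marker_mul_le_prob (p : E → R) (hp : IsProbVec p) (arcs : E → Finset (V × V))
    (s a b : V) (D : Set (Config E)) :
    massE p (fun ω => marker (R := R) arcs s a ω * marker (R := R) arcs s b ω) D ≤ prob p D := by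
  rw [massE_marker_mul_eq_prob]
  exact prob_mono hp Set.inter_subset_right

/-- **The BASE row on mixed coin systems** (directed BHK 1.3, cleared):
`phiC p arcs s T a b (avoidEvent arcs s T) = P(R_T) · covC(R_T) ≥ 0`. -/
theorem base_nonneg (p : E → R) (hp : IsProbVec p) {arcs : E → Finset (V × V)}
    (hS : SameEnds arcs) (s : V) (T : Finset V) (a b : V) :
    0 ≤ phiC p arcs s T a b (avoidEvent arcs s T) := by
  have hcov := covC_nonneg p hp hS s a b T
  have hid : phiC p arcs s T a b (avoidEvent arcs s T) =
      prob p (avoidEvent arcs s T) * covC p arcs s a b (avoidEvent arcs s T) := by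
    simp only [phiC, covC]
    ring
  rw [hid]
  exact mul_nonneg (prob_nonneg hp _) hcov

/-- **Lemma A on mixed coin systems** (avoid-more positivity, cleared): for every further avoided
set `U`, `phiC p arcs s T a b (avoidEvent arcs s (T ∪ U)) ≥ 0`, i.e.
`E[(X − m_X)(Y − m_Y); s ↛ T ∪ U] ≥ 0` with `m = E[· | s ↛ T]`. -/
theorem lemmaA_nonneg (p : E → R) (hp : IsProbVec p) {arcs : E → Finset (V × V)}
    (hS : SameEnds arcs) (s : V) (T U : Finset V) (a b : V) :
    0 ≤ phiC p arcs s T a b (avoidEvent arcs s (T ∪ U)) := by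
  have hTU : T ⊆ T ∪ U := Finset.subset_union_left
  have hbhk := covC_nonneg p hp hS s a b (T ∪ U)
  have hA := shift_avoid_more_C p hp hS s a hTU
  have hB := shift_avoid_more_C p hp hS s b hTU
  simp only [phiC, covC] at hbhk ⊢
  set P := prob p (avoidEvent arcs s T) with hP
  set PU := prob p (avoidEvent arcs s (T ∪ U)) with hPU
  set XY := massE p (fun ω => marker (R := R) arcs s a ω * marker (R := R) arcs s b ω)
    (avoidEvent arcs s (T ∪ U)) with hXY
  set X0 := massE p (marker (R := R) arcs s a) (avoidEvent arcs s T) with hX0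
  set Y0 := massE p (marker (R := R) arcs s b) (avoidEvent arcs s T) with hY0
  set XU := massE p (marker (R := R) arcs s a) (avoidEvent arcs s (T ∪ U)) with hXU
  set YU := massE p (marker (R := R) arcs s b) (avoidEvent arcs s (T ∪ U)) with hYU
  have hPU0 : 0 ≤ PU := prob_nonneg hp _
  have hXU0 : 0 ≤ XU := massE_marker_nonneg p hp arcs s a _
  have hYU0 : 0 ≤ YU := massE_marker_nonneg p hp arcs s b _
  have hXY0 : 0 ≤ XY := massE_marker_mul_nonneg p hp arcs s a b _
  have hXUle : XU ≤ PU := massE_marker_le_prob p hp arcs s a _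
  have hYUle : YU ≤ PU := massE_marker_le_prob p hp arcs s b _
  have hXYle : XY ≤ PU := massE_marker_mul_le_prob p hp arcs s a b _
  rcases hPU0.lt_or_eq with hpos | hzero
  · have hid : PU * (P ^ 2 * XY - P * X0 * YU - P * Y0 * XU + X0 * Y0 * PU) =
        P ^ 2 * (PU * XY - XU * YU) + (XU * P - X0 * PU) * (YU * P - Y0 * PU) := by ring
    have h1 : 0 ≤ P ^ 2 * (PU * XY - XU * YU) := mul_nonneg (sq_nonneg _) hbhk
    have h2 : 0 ≤ (XU * P - X0 * PU) * (YU * P - Y0 * PU) :=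
      mul_nonneg_of_nonpos_of_nonpos (by linarith) (by linarith)
    have : 0 ≤ PU * (P ^ 2 * XY - P * X0 * YU - P * Y0 * XU + X0 * Y0 * PU) := by
      rw [hid]; linarith
    exact (mul_nonneg_iff_of_pos_left hpos).1 this
  · have hXUz : XU = 0 := le_antisymm (hzero ▸ hXUle) hXU0
    have hYUz : YU = 0 := le_antisymm (hzero ▸ hYUle) hYU0
    have hXYz : XY = 0 := le_antisymm (hzero ▸ hXYle) hXY0
    rw [hXUz, hYUz, hXYz, ← hzero]
    ring_nf
    exact le_refl _

/-- **Row 2′DARC at an arc into the target** (`w ∈ T`): the gate event is the S-avoidance event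
`R_{T ∪ {u}}` (`gateEvent_eq_union`: `{w ∉ K⁻}` is empty for `w ∈ T`), so `DARC` is Lemma A. -/
theorem darc_of_head_in_target (p : E → R) (hp : IsProbVec p) {arcs : E → Finset (V × V)}
    (hS : SameEnds arcs) (s : V) (T : Finset V) (a b u w : V) (hw : w ∈ T) :
    DARC p arcs s T a b u w := by
  unfold DARC
  have hgate : gateEvent arcs s T u w = avoidEvent arcs s (T ∪ {u}) := by
    rw [gateEvent_eq_union]
    ext ω
    simp only [Set.mem_inter_iff, Set.mem_union, Set.mem_compl_iff, avoidEvent, fwdEvent, bwdEvent,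
      Set.mem_setOf_eq, Finset.mem_union, Finset.mem_singleton]
    constructor
    · rintro ⟨hR, h | h⟩
      · intro t ht
        rcases ht with ht | rfl
        · exact hR t ht
        · exact h
      · exfalso
        exact h ⟨w, hw, reach_refl _ _ _⟩
    · intro h
      refine ⟨fun t ht => h t (Or.inl ht), Or.inl (h u (Or.inr rfl))⟩
  rw [hgate]
  exact lemmaA_nonneg p hp hS s T {u} a b

/-- **Row 2′DARC at an arc out of the target** (`u ∈ T`): on `R_T` the tail `u` is never in `S⁺`,
so the gate event is `R_T` itself and `DARC` is the BASE row. -/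
theorem darc_of_tail_in_target (p : E → R) (hp : IsProbVec p) {arcs : E → Finset (V × V)}
    (hS : SameEnds arcs) (s : V) (T : Finset V) (a b u w : V) (hu : u ∈ T) :
    DARC p arcs s T a b u w := by
  unfold DARC
  have hgate : gateEvent arcs s T u w = avoidEvent arcs s T := by
    rw [gateEvent_eq_union]
    ext ω
    simp only [Set.mem_inter_iff, Set.mem_union, Set.mem_compl_iff, avoidEvent, fwdEvent,
      Set.mem_setOf_eq]
    constructor
    · rintro ⟨hR, _⟩
      exact hR
    · intro hR
      exact ⟨hR, Or.inl (hR u hu)⟩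
  rw [hgate]
  exact base_nonneg p hp hS s T a b

/-- **Row 2′DARC at an arc into the root** (`w = s`): on `R_T` the head `s` is never in `K⁻`, so
the gate event is `R_T` itself and `DARC` is the BASE row. -/
theorem darc_of_head_eq_root (p : E → R) (hp : IsProbVec p) {arcs : E → Finset (V × V)}
    (hS : SameEnds arcs) (s : V) (T : Finset V) (a b u : V) :
    DARC p arcs s T a b u s := by
  unfold DARC
  have hgate : gateEvent arcs s T u s = avoidEvent arcs s T := by
    rw [gateEvent_eq_union]
    ext ω
    simp only [Set.mem_inter_iff, Set.mem_union, Set.mem_compl_iff, avoidEvent, bwdEvent,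
      Set.mem_setOf_eq]
    constructor
    · rintro ⟨hR, _⟩
      exact hR
    · intro hR
      refine ⟨hR, Or.inr ?_⟩
      rintro ⟨t, ht, hst⟩
      exact hR t ht hst
  rw [hgate]
  exact base_nonneg p hp hS s T a b

end LemmaA

end Summit.Ventures.PercRepro2.Coin
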